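import Summits.BirchSwinnertonDyer.BirchSwinnertonDyer.Theses.VerticalContact
import Literature.NumberTheory.EllipticCurves.CuspFormLFunction
import HarnessLib

/-!
# BirchSwinnertonDyer / VerticalContact — crux `PGSelmerBSD` (stmt-BirchSwinnertonDyer-17810),
# line `Sketch`, stub 2 `stub_modular`: reduction to the Modularity Theorem

Stub 2 of the registered skeleton of line `Sketch` (`Cruxes/PGSelmerBSD/Lines/Sketch.lean`) asks,
for every globally minimal Weierstrass equation `W` of an elliptic curve over `ℚ`, for SOME level
`N ≠ 0` and a weight-`2` cusp form `f ∈ S₂(Γ₀(N))` attached to `W` (`IsNewformOf W f`: `f` is a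
newform with `aₙ(f) = aₙ(W)` for all `n`) — the modularity supply for the Mazur–Tate–Teitelbaum
`p`-adic `L`-function `padicLFunction f (unitRoot W p)` in which Kato's bound and the line's
transfer target are stated.

This is the Modularity Theorem (Wiles 1995; Taylor–Wiles 1995; Breuil–Conrad–Diamond–Taylor
2001, Thm. A; level `N_E` by Carayol 1986; Diamond–Shurman 2005, Thm. 8.8.3), in the tree the
named fact `Literature.NumberTheory.EllipticCurves.ModularForms.exists_isNewformOf`
(`Literature/NumberTheory/EllipticCurves/CuspFormLFunction.lean`), a `def … : Prop` that is NOT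
discharged in the tree: only conditional derivations exist, e.g.
`Literature.NumberTheory.Automorphic.BCDT.exists_isNewformOf_of_theoremB_of_CDT` from the named
facts `Literature.NumberTheory.Automorphic.BCDT.theoremB` (BCDT Thm. B) and
`Literature.NumberTheory.Automorphic.BCDT.CDT_theorem_7_2_4` (Conrad–Diamond–Taylor 1999,
Thm. 7.2.4; reduced in `CDTTheorem724Assembly.lean` to `CDT_theorem_7_2_1`, `CDT_theorem_7_2_2`,
`CDT_lemma_7_2_3_isModular`, `CDT_three_five_switch`, all undischarged). Hence the stub cannot be
landed under its registered hypothesis-free name today. This file records the reduction,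
kernel-checked: `stub_modular_of_modularity (hmod : exists_isNewformOf)` yields the registered
statement of stub 2 verbatim (`stub_modular_of_facts` is its colon form
`exists_isNewformOf → …`), with `N := W.conductorNorm ℤ`, the instance `NeZero N` from the tree
theorem `WeierstrassCurve.conductorNorm_pos_holds`, and `f` from `hmod W`. CONDITIONAL on
that one named fact; no definition, no new named fact; it SUPPORTS stmt-BirchSwinnertonDyer-17810
(it does not close it, and it does not land stub 2 under its registered name). The instance
`[W.IsGloballyMinimal]` of the registered signature is not used. Nothing shaped like the crux or
like the neighbouring stubs 1, 3–6 is stated.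

References: C. Breuil, B. Conrad, F. Diamond, R. Taylor, *On the modularity of elliptic curves
over `ℚ`: wild 3-adic exercises*, J. Amer. Math. Soc. 14 (2001) 843–939, Thm. A
[BreuilConradDiamondTaylor2001]; F. Diamond, J. Shurman, *A first course in modular forms*,
GTM 228 (2005), Thm. 8.8.3 [DiamondShurman2005].
-/

-- D-0017: single-problem summit, so `Summit.BirchSwinnertonDyer.BirchSwinnertonDyer.…` repeats a
-- namespace BY DESIGN.
set_option linter.dupNamespace false

namespace Summit.BirchSwinnertonDyer.BirchSwinnertonDyer.Theorems

open scoped MatrixGroups ModularForm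
open CongruenceSubgroup Literature.NumberTheory.EllipticCurves.ModularForms

/-- **Stub 2 (`stub_modular`) of line `Sketch` for crux `VerticalContact.PGSelmerBSD`
(stmt-BirchSwinnertonDyer-17810), from the Modularity Theorem.** Assume
`Literature.NumberTheory.EllipticCurves.ModularForms.exists_isNewformOf` (every elliptic curve
`E / ℚ` of conductor `N_E` has a newform `f ∈ S₂(Γ₀(N_E))` with `aₙ(f) = aₙ(E)`: Wiles 1995;
Taylor–Wiles 1995; Breuil–Conrad–Diamond–Taylor 2001, Thm. A; Diamond–Shurman 2005, Thm. 8.8.3).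
Then every globally minimal Weierstrass equation `W` of an elliptic curve over `ℚ` has, at some
level `N ≠ 0`, a weight-`2` cusp form `f ∈ S₂(Γ₀(N))` with `IsNewformOf W f`. Proof: take
`N := W.conductorNorm ℤ`, non-zero by the tree theorem `WeierstrassCurve.conductorNorm_pos_holds`
(Silverman *AEC* C.16), and `f` from the hypothesis at `W`. Global minimality is not used.
[cite: BreuilConradDiamondTaylor2001, Thm. A] [cite: DiamondShurman2005, Thm. 8.8.3] -/
theorem stub_modular_of_modularity
    (hmod : Literature.NumberTheory.EllipticCurves.ModularForms.exists_isNewformOf) :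
    ∀ (W : WeierstrassCurve ℚ) [W.IsElliptic] [W.IsGloballyMinimal],
      ∃ (N : ℕ) (_ : NeZero N) (f : CuspForm (Gamma0 N) 2), IsNewformOf W f := by
  intro W _ _
  -- the conductor `N_E ≥ 1` of `W` is the level
  haveI hN : NeZero (W.conductorNorm ℤ) := ⟨(W.conductorNorm_pos_holds).ne'⟩
  -- the newform of `W` at level `N_E` (modularity)
  obtain ⟨f, hf⟩ := hmod W
  exact ⟨W.conductorNorm ℤ, hN, f, hf⟩

/-- **Registered-shape colon form (`exists_isNewformOf → (stub 2 verbatim)`) of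
`stub_modular_of_modularity`:** the Modularity Theorem (Breuil–Conrad–Diamond–Taylor 2001,
Thm. A; Diamond–Shurman 2005, Thm. 8.8.3), in the tree's form `exists_isNewformOf`, implies the
statement of stub 2 `stub_modular` of line `Sketch` (crux `PGSelmerBSD`,
stmt-BirchSwinnertonDyer-17810) verbatim. [cite: BreuilConradDiamondTaylor2001, Thm. A]
[cite: DiamondShurman2005, Thm. 8.8.3] -/
theorem stub_modular_of_facts :
    Literature.NumberTheory.EllipticCurves.ModularForms.exists_isNewformOf →
      ∀ (W : WeierstrassCurve ℚ) [W.IsElliptic] [W.IsGloballyMinimal],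
        ∃ (N : ℕ) (_ : NeZero N) (f : CuspForm (Gamma0 N) 2), IsNewformOf W f :=
  fun hmod ↦ stub_modular_of_modularity hmod

end Summit.BirchSwinnertonDyer.BirchSwinnertonDyer.Theorems
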